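import Summits.Ventures.YMGap.RobustBall.LoopObservable
import Summits.Ventures.YMGap.RobustBall.PairGaugeInvariance
import Summits.Ventures.YMGap.RobustBall.RowsS
import Summits.Ventures.YMGap.RobustBall.RowsSN
import HarnessLib

/-!
# Venture YMGap, track ROBUST-BALL (tier 2) — THE NORM BALL OF GENERIC WILSON-TYPE LOOP ACTIONS is inside the
# weighted ball: mass gap uniformly on `‖c‖_w ≤ ε`

HONEST FRAMING. WHAT THIS IS: a venture file (cell `pub-ymgap`, track Y2 ROBUST-BALL, seat rb-p1) typing the
directive's object on `ℤ^d` — "the set of lattice gauge actions within `ε` of the Wilson action in a weighted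
non-local Banach norm (weights growing with the diameter/support of the interaction term)" — for the GENERIC
WILSON-TYPE ACTIONS `S = S_Wilson + ∑_i c_i · Re tr(U_{γ_i}) / N`: an ARBITRARY family `γ : ι → ZdLoop d` of closed
lattice loops (any shapes, any sizes, any base points — position-dependent couplings allowed; finitely many
active loops per carrier) with couplings `c : ι → ℝ`, as the link potential `loopFamilyAction N γ c`
(`indexedPotential` of the loop terms of `LoopObservable.lean`). THE NORM: seen from a link `e`, the term `i`
weighs `|c_i| · ∑_{y ∈ γ_i} mult_i(y) e^{w‖e − y‖_∞}` (`loopWeightAt`; `≤ |c_i| · |γ_i| · e^{w·diam γ_i}`), and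
`LoopNormLE w γ c ε` says `sup_e ∑_{i : e ∈ γ_i} (that) ≤ ε` — a weighted `ℓ¹/ℓ^∞` norm ball of radius `ε`.
MAIN THEOREM `memBallZdS_loopFamilyAction`: `‖c‖_w ≤ ε ⇒ loopFamilyAction N γ c ∈ MemBallZdS (2ε) ε w`, the
one-parameter tier-2 ball of the track's rows; hence (`perturbedMassGapAtS_loopFamilyAction`) EVERY landed
tier-2 row `MassGapOnBallZdS d N β (2ε) ε w` yields the mass gap (unique DLR state + exponential clustering,
`PerturbedMassGapAtS`) UNIFORMLY ON THE LOOP-ACTION NORM BALL — cells: `SU(2)`, `d = 4`, `β_W = 1/16`, weight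
`2^{dist}`, radius `0.143` (`su2_loopFamily_massGapS_1_16`); every `N ≥ 2` at 't Hooft `1/64`, weight `(6/5)^{dist}`,
radius `1/40` (`suN_loopFamily_massGapS_1_64`); `SU(3)` at `β_W = 1/8` given the two certified one-link constants
(`su3_loopFamily_massGapS_1_8`). Every term is gauge invariant (`isZdGaugeInvariant_loopFamilyAction`).
WHAT IT IS NOT: strong-coupling lattice statements inside the rows' one-sided windows; radii are door
artefacts; nothing about the continuum limit or the Clay Millennium problem.

References: K. G. Wilson, Phys. Rev. D 10 (1974) 2445 (loop actions); E. Seiler, LNP 159 (1982) Ch. 1; the ball,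
loads and rows are this track's (`MassGapOnBallS.lean`, `RowsS.lean`, `RowsSN.lean`).
-/

noncomputable section

open MeasureTheory Filter Function Topology Real SimpleGraph
open Literature.Probability.LatticeModels
open Literature.Probability.LatticeModels.DobrushinMetric
open Literature.MathematicalPhysics.QuantumLattice
open Literature.MathematicalPhysics.QuantumFieldTheory hiding ZdEdge Site
open Summit.QuantumFields.BalabanUV.InfraRed.StrongCouplingPoincareDoorSUN (OneLinkPoincareSUN)
open Summit.QuantumFields.BalabanUV.InfraRed.StrongCouplingVarianceDoorSUN (OneLinkVarianceBound)

namespace Summit.Ventures.YMGap.RobustBall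

variable {d N : ℕ} {ι : Type*}

/-! ### Closed loops, carrier fibres, the loop-family action -/

section Objects

variable (d) in
/-- A closed lattice loop on `ℤ^d`: a base point and a closed walk of the nearest-neighbour graph there. -/
structure ZdLoop where
  /-- the base point -/
  base : Site d
  /-- the closed walk -/
  walk : (zdGraph d).Walk base base

open Classical in
/-- The fibre of a carrier map `code : ι → Finset (ZdEdge d)` over the link set `X`, as a finite set (the junk
value `∅` when the fibre is infinite; see `mem_carrierFib`). -/
def carrierFib (code : ι → Finset (ZdEdge d)) (X : Finset (ZdEdge d)) : Finset ι :=
  if h : {i | code i = X}.Finite then h.toFinset else ∅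

/-- For a carrier map with finite fibres, `carrierFib code X` is exactly the fibre over `X`. -/
theorem mem_carrierFib {code : ι → Finset (ZdEdge d)} (hfin : ∀ X, {i | code i = X}.Finite)
    (X : Finset (ZdEdge d)) (i : ι) : i ∈ carrierFib code X ↔ code i = X := by
  unfold carrierFib
  rw [dif_pos (hfin X), Set.Finite.mem_toFinset]
  rfl

variable (N) in
/-- **The loop-family action**: the link potential of the generic Wilson-type action
`∑_i c_i · Re tr(U_{γ_i}) / N` — on the link set `X`, the sum of the loop terms `loopTerm N (c i) (γ i).walk`
whose carrier `walkEdges (γ i).walk` is `X`. -/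
def loopFamilyAction (γ : ι → ZdLoop d) (c : ι → ℝ) : Potential (ZdEdge d) (SUN N) :=
  indexedPotential (carrierFib fun i => walkEdges (γ i).walk) fun i => loopTerm N (c i) (γ i).walk

/-- **Every term of the loop-family action is gauge invariant.** -/
theorem isZdGaugeInvariant_loopFamilyAction (γ : ι → ZdLoop d) (c : ι → ℝ) (X : Finset (ZdEdge d)) :
    IsZdGaugeInvariant (loopFamilyAction (d := d) N γ c X) :=
  isZdGaugeInvariant_indexedPotential (fun i => isZdGaugeInvariant_loopTerm (γ i).walk) X

end Objects

/-! ### The weighted non-local norm -/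

section Norm

/-- **The weight of the term `i` seen from the link `e`** at rate `w`:
`|c_i| · ∑_{y ∈ γ_i} mult_i(y) e^{w‖e − y‖_∞}` if `e` lies on `γ_i`, else `0`
(at most `|c_i| · |γ_i| · e^{w · diam γ_i}`: the weight grows with the support and the diameter of the term). -/
def loopWeightAt (w : ℝ) (γ : ι → ZdLoop d) (c : ι → ℝ) (e : ZdEdge d) (i : ι) : ℝ :=
  if e ∈ walkEdges (γ i).walk then
    |c i| * ∑ y ∈ walkEdges (γ i).walk, (dartMult (γ i).walk y : ℝ) * exp (w * ‖e.1 - y.1‖)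
  else 0

/-- **The loop-action norm is at most `ε` at rate `w`** (`ε ≥ 0`): through EVERY link `e` the weights of the
terms on `e` are summable with `∑_{i : e ∈ γ_i} |c_i| ∑_{y ∈ γ_i} mult_i(y) e^{w‖e − y‖_∞} ≤ ε` — the ball of
radius `ε` of the weighted `sup_e ∑_{i ∋ e}` norm on coupling families. -/
structure LoopNormLE (w : ℝ) (γ : ι → ZdLoop d) (c : ι → ℝ) (ε : ℝ) : Prop where
  /-- the radius is nonnegative -/
  nonneg : 0 ≤ ε
  /-- through every link the weights are summable -/
  summable : ∀ e : ZdEdge d, Summable (loopWeightAt w γ c e)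
  /-- through every link the weights sum to at most `ε` -/
  tsum_le : ∀ e : ZdEdge d, ∑' i, loopWeightAt w γ c e i ≤ ε

variable {w : ℝ} {γ : ι → ZdLoop d} {c : ι → ℝ} {ε : ℝ}

/-- The weights are nonnegative. -/
theorem loopWeightAt_nonneg (w : ℝ) (γ : ι → ZdLoop d) (c : ι → ℝ) (e : ZdEdge d) (i : ι) :
    0 ≤ loopWeightAt w γ c e i := by
  unfold loopWeightAt
  split_ifs
  · exact mul_nonneg (abs_nonneg _) (Finset.sum_nonneg fun y _ => by positivity)
  · exact le_rfl

/-- Monotonicity of the norm ball in the radius. -/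
theorem LoopNormLE.mono (h : LoopNormLE w γ c ε) {ε' : ℝ} (hε : ε ≤ ε') : LoopNormLE w γ c ε' :=
  ⟨h.nonneg.trans hε, h.summable, fun e => (h.tsum_le e).trans hε⟩

/-- **The weight dominates the coupling**: on a link of `γ_i`, `|c_i| ≤ loopWeightAt w γ c e i` (the link itself
contributes `mult_i(e) e^0 ≥ 1`). -/
theorem abs_coupling_le_loopWeightAt {e : ZdEdge d} {i : ι} (he : e ∈ walkEdges (γ i).walk) :
    |c i| ≤ loopWeightAt w γ c e i := by
  unfold loopWeightAt
  rw [if_pos he]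
  refine le_mul_of_one_le_right (abs_nonneg _) ?_
  have hone : (1 : ℝ) ≤ (dartMult (γ i).walk e : ℝ) * exp (w * ‖e.1 - e.1‖) := by
    rw [sub_self, norm_zero, mul_zero, exp_zero, mul_one]
    exact_mod_cast one_le_dartMult_of_mem _ he
  exact hone.trans (Finset.single_le_sum (f := fun y => (dartMult (γ i).walk y : ℝ) * exp (w * ‖e.1 - y.1‖))
    (fun y _ => by positivity) he)

/-- **The weight dominates the self-modulus**: `|c_i| mult_i(e) ≤ loopWeightAt w γ c e i` on a link of `γ_i`. -/
theorem abs_coupling_mul_dartMult_le_loopWeightAt {e : ZdEdge d} {i : ι} (he : e ∈ walkEdges (γ i).walk) :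
    |c i| * dartMult (γ i).walk e ≤ loopWeightAt w γ c e i := by
  unfold loopWeightAt
  rw [if_pos he]
  refine mul_le_mul_of_nonneg_left ?_ (abs_nonneg _)
  have hself : (dartMult (γ i).walk e : ℝ) = (dartMult (γ i).walk e : ℝ) * exp (w * ‖e.1 - e.1‖) := by
    rw [sub_self, norm_zero, mul_zero, exp_zero, mul_one]
  rw [hself]
  exact Finset.single_le_sum (f := fun y => (dartMult (γ i).walk y : ℝ) * exp (w * ‖e.1 - y.1‖))
    (fun y _ => by positivity) he

/-- **The weight dominates the weighted cross row**:
`∑_{y ∈ γ_i ∖ e} |c_i| mult_i(y) e^{w‖e−y‖} ≤ loopWeightAt w γ c e i` on a link of `γ_i`. -/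
theorem sum_erase_le_loopWeightAt {e : ZdEdge d} {i : ι} (he : e ∈ walkEdges (γ i).walk) :
    ∑ y ∈ (walkEdges (γ i).walk).erase e, |c i| * (dartMult (γ i).walk y : ℝ) * exp (w * ‖e.1 - y.1‖) ≤
      loopWeightAt w γ c e i := by
  unfold loopWeightAt
  rw [if_pos he, Finset.mul_sum]
  simp_rw [mul_assoc]
  exact Finset.sum_le_sum_of_subset_of_nonneg (Finset.erase_subset _ _) fun y _ _ => by positivity

end Norm

/-! ### Membership in the weighted ball -/

section Member

variable {w : ℝ} {γ : ι → ZdLoop d} {c : ι → ℝ} {ε : ℝ}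

/-- Domination transfers summability from the weights to a nonnegative family supported on the terms through
`e`. -/
theorem summable_of_le_loopWeightAt (h : LoopNormLE w γ c ε) (e : ZdEdge d) {g : ι → ℝ} (hg0 : ∀ i, 0 ≤ g i)
    (hg : ∀ i, g i ≤ loopWeightAt w γ c e i) : Summable g ∧ ∑' i, g i ≤ ε :=
  ⟨(h.summable e).of_nonneg_of_le hg0 hg,
    (Summable.tsum_le_tsum hg ((h.summable e).of_nonneg_of_le hg0 hg) (h.summable e)).trans (h.tsum_le e)⟩

/-- **THE LOOP-ACTION NORM BALL IS INSIDE THE WEIGHTED BALL (sharp form)**: if every carrier fibre is finite and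
`‖c‖_w ≤ ε` then `loopFamilyAction N γ c ∈ MemBallZdS (2ε) (ε/√N) w`. -/
theorem memBallZdS_loopFamilyAction_sharp (hfin : ∀ X, {i | walkEdges (γ i).walk = X}.Finite)
    (h : LoopNormLE w γ c ε) : MemBallZdS (2 * ε) (ε / Real.sqrt N) w (loopFamilyAction (d := d) N γ c) := by
  classical
  have hW0 := loopWeightAt_nonneg w γ c
  have hsq0 : 0 ≤ (Real.sqrt N)⁻¹ := inv_nonneg.2 (Real.sqrt_nonneg _)
  -- (M) termwise bounds `|c_i|`
  have hM : ∀ e : ZdEdge d, Summable fun i => if e ∈ walkEdges (γ i).walk then |c i| else 0 := fun e =>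
    (summable_of_le_loopWeightAt h e (g := fun i => if e ∈ walkEdges (γ i).walk then |c i| else 0)
      (fun i => by positivity) fun i => by
        by_cases he : e ∈ walkEdges (γ i).walk
        · rw [if_pos he]; exact abs_coupling_le_loopWeightAt he
        · rw [if_neg he]; exact hW0 e i).1
  -- (o) oscillations `2|c_i|`
  have ho : ∀ e : ZdEdge d, (Summable fun i => if e ∈ walkEdges (γ i).walk then 2 * |c i| else 0) ∧
      ∑' i, (if e ∈ walkEdges (γ i).walk then 2 * |c i| else 0) ≤ 2 * ε := by
    intro e
    have h2 := summable_of_le_loopWeightAt h e (g := fun i => if e ∈ walkEdges (γ i).walk then |c i| else 0)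
      (fun i => by positivity) fun i => by
        by_cases he : e ∈ walkEdges (γ i).walk
        · rw [if_pos he]; exact abs_coupling_le_loopWeightAt he
        · rw [if_neg he]; exact hW0 e i
    have heq : (fun i => if e ∈ walkEdges (γ i).walk then 2 * |c i| else 0) =
        fun i => 2 * (if e ∈ walkEdges (γ i).walk then |c i| else 0) := by
      funext i; split_ifs <;> ring
    rw [heq]
    refine ⟨h2.1.mul_left 2, ?_⟩
    rw [tsum_mul_left]
    linarith [h2.2]
  -- (l self) self-moduli `|c_i| mult_i(e) / √N`
  have hl : ∀ e : ZdEdge d, Summable fun i =>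
      if e ∈ walkEdges (γ i).walk then |c i| * (dartMult (γ i).walk e / Real.sqrt N) else 0 := by
    intro e
    have h1 := summable_of_le_loopWeightAt h e
      (g := fun i => if e ∈ walkEdges (γ i).walk then |c i| * (dartMult (γ i).walk e : ℝ) else 0)
      (fun i => by positivity) fun i => by
        by_cases he : e ∈ walkEdges (γ i).walk
        · rw [if_pos he]; exact abs_coupling_mul_dartMult_le_loopWeightAt he
        · rw [if_neg he]; exact hW0 e i
    refine (h1.1.mul_right (Real.sqrt N)⁻¹).congr fun i => ?_
    split_ifs
    · rw [div_eq_mul_inv]; ring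
    · rw [zero_mul]
  -- (row) weighted cross rows `≤ loopWeightAt / √N`
  have hrow : ∀ e : ZdEdge d,
      (Summable fun i => if e ∈ walkEdges (γ i).walk then
        ∑ y ∈ (walkEdges (γ i).walk).erase e, |c i| * (dartMult (γ i).walk y / Real.sqrt N) * exp (w * ‖e.1 - y.1‖)
        else 0) ∧
      ∑' i, (if e ∈ walkEdges (γ i).walk then
        ∑ y ∈ (walkEdges (γ i).walk).erase e, |c i| * (dartMult (γ i).walk y / Real.sqrt N) * exp (w * ‖e.1 - y.1‖)
        else 0) ≤ ε / Real.sqrt N := by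
    intro e
    have h1 := summable_of_le_loopWeightAt h e
      (g := fun i => if e ∈ walkEdges (γ i).walk then
        ∑ y ∈ (walkEdges (γ i).walk).erase e, |c i| * (dartMult (γ i).walk y : ℝ) * exp (w * ‖e.1 - y.1‖) else 0)
      (fun i => by
        split_ifs
        · exact Finset.sum_nonneg fun y _ => by positivity
        · exact le_rfl) fun i => by
        by_cases he : e ∈ walkEdges (γ i).walk
        · rw [if_pos he]; exact sum_erase_le_loopWeightAt he
        · rw [if_neg he]; exact hW0 e i
    have heq : (fun i => if e ∈ walkEdges (γ i).walk then
        ∑ y ∈ (walkEdges (γ i).walk).erase e, |c i| * (dartMult (γ i).walk y / Real.sqrt N) * exp (w * ‖e.1 - y.1‖)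
        else 0) = fun i => (if e ∈ walkEdges (γ i).walk then
        ∑ y ∈ (walkEdges (γ i).walk).erase e, |c i| * (dartMult (γ i).walk y : ℝ) * exp (w * ‖e.1 - y.1‖) else 0) *
          (Real.sqrt N)⁻¹ := by
      funext i
      split_ifs
      · rw [Finset.sum_mul]
        exact Finset.sum_congr rfl fun y _ => by rw [div_eq_mul_inv]; ring
      · rw [zero_mul]
    rw [heq]
    refine ⟨h1.1.mul_right _, ?_⟩
    rw [tsum_mul_right, div_eq_mul_inv]
    exact mul_le_mul_of_nonneg_right h1.2 hsq0
  -- assemble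
  exact memBallZdS_indexed (code := fun i => walkEdges (γ i).walk) (fib := carrierFib fun i => walkEdges (γ i).walk)
    (φ := fun i => loopTerm N (c i) (γ i).walk) (mem_carrierFib hfin) (fun i => continuous_loopTerm (γ i).walk)
    (fun i => dependsOn_loopTerm (γ i).walk) (M := fun i => |c i|) (fun i U => abs_loopTerm_le (γ i).walk U) hM
    (fun i => isOscBound_loopTerm (γ i).walk) (fun i => isLipBound_loopTerm (γ i).walk) (t := w)
    (fun e => (ho e).1) (fun e => (ho e).2) hl (fun e => (hrow e).1) (fun e => (hrow e).2)

/-- **THE LOOP-ACTION NORM BALL IS INSIDE THE WEIGHTED BALL**: if every carrier fibre is finite and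
`‖c‖_w ≤ ε` then `loopFamilyAction N γ c ∈ MemBallZdS (2ε) ε w` — the one-parameter tier-2 ball of the track's
rows (`ε/√N ≤ ε`). -/
theorem memBallZdS_loopFamilyAction (hfin : ∀ X, {i | walkEdges (γ i).walk = X}.Finite) (h : LoopNormLE w γ c ε) :
    MemBallZdS (2 * ε) ε w (loopFamilyAction (d := d) N γ c) := by
  have hε : 0 ≤ ε := h.nonneg
  refine (memBallZdS_loopFamilyAction_sharp hfin h).mono le_rfl ?_
  rcases Nat.eq_zero_or_pos N with hN | hN
  · subst hN; simpa using hε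
  · have h1 : (1 : ℝ) ≤ Real.sqrt N := by
      rw [← Real.sqrt_one]; exact Real.sqrt_le_sqrt (by exact_mod_cast hN)
    exact div_le_self hε h1

/-- **MASS GAP UNIFORMLY ON THE LOOP-ACTION NORM BALL**: every tier-2 row `MassGapOnBallZdS d N β (2ε) ε w` yields,
for EVERY loop family with finite carrier fibres and EVERY coupling family of norm `‖c‖_w ≤ ε`, the mass gap
`PerturbedMassGapAtS d N β (loopFamilyAction N γ c)` (unique DLR state and exponential clustering). -/
theorem perturbedMassGapAtS_loopFamilyAction {β : ℝ} (hrow : MassGapOnBallZdS d N β (2 * ε) ε w)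
    (hfin : ∀ X, {i | walkEdges (γ i).walk = X}.Finite) (h : LoopNormLE w γ c ε) :
    PerturbedMassGapAtS d N β (loopFamilyAction (d := d) N γ c) :=
  hrow _ (memBallZdS_loopFamilyAction hfin h)

variable (d N) in
/-- **THE TARGET TYPE — mass gap uniformly on the loop-action norm ball** of radius `ε` at rate `w` ('t Hooft
coupling `β`): EVERY generic Wilson-type loop action `loopFamilyAction N γ c` (any index set, finite carrier fibres)
with `‖c‖_w ≤ ε` has the mass gap `PerturbedMassGapAtS d N β`. Nothing is asserted by the definition. -/
def MassGapOnLoopBall (β w ε : ℝ) : Prop :=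
  ∀ (ι : Type) (γ : ι → ZdLoop d) (c : ι → ℝ), (∀ X, {i | walkEdges (γ i).walk = X}.Finite) →
    LoopNormLE w γ c ε → PerturbedMassGapAtS d N β (loopFamilyAction (d := d) N γ c)

/-- **Every tier-2 row is a row on the loop-action norm ball**: `MassGapOnBallZdS d N β (2ε) ε w` implies
`MassGapOnLoopBall d N β w ε`. -/
theorem MassGapOnBallZdS.massGapOnLoopBall {β : ℝ} (hrow : MassGapOnBallZdS d N β (2 * ε) ε w) :
    MassGapOnLoopBall d N β w ε :=
  fun _ _ _ hfin h => perturbedMassGapAtS_loopFamilyAction hrow hfin h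

end Member

/-! ### Cells: the landed tier-2 rows read on the loop-action norm ball -/

section Rows

variable {γ : ι → ZdLoop 4} {c : ι → ℝ}

/-- **`SU(2)`, `d = 4`, `β_W = 1/16`** (tree slot `(1/16)/4`): every generic Wilson-type loop action with finite
carrier fibres and `‖c‖_{log 2} ≤ 0.143` — i.e. `∑_{i : e ∈ γ_i} |c_i| ∑_{y ∈ γ_i} mult_i(y) 2^{‖e−y‖_∞} ≤ 0.143`
through every link `e` — has the mass gap (row `su2_rowBS2_1_16`). -/
theorem su2_loopFamily_massGapS_1_16 (hfin : ∀ X, {i | walkEdges (γ i).walk = X}.Finite)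
    (h : LoopNormLE (Real.log 2) γ c (143 / 1000)) :
    PerturbedMassGapAtS 4 2 ((1 / 16 : ℝ) / 4) (loopFamilyAction (d := 4) 2 γ c) :=
  perturbedMassGapAtS_loopFamilyAction su2_rowBS2_1_16 hfin h

/-- **`SU(2)`, `d = 4`, `β_W = 1/20`**: radius `0.209` at weight `2^{dist}` (row `su2_rowBS2_1_20`). -/
theorem su2_loopFamily_massGapS_1_20 (hfin : ∀ X, {i | walkEdges (γ i).walk = X}.Finite)
    (h : LoopNormLE (Real.log 2) γ c (209 / 1000)) :
    PerturbedMassGapAtS 4 2 ((1 / 20 : ℝ) / 4) (loopFamilyAction (d := 4) 2 γ c) :=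
  perturbedMassGapAtS_loopFamilyAction su2_rowBS2_1_20 hfin h

/-- **`SU(2)`, `d = 4`, `β_W = 1/16`, slower weight `(3/2)^{dist}`**: radius `0.186` (row `su2_rowS32_1_16`). -/
theorem su2_loopFamily_massGapS32_1_16 (hfin : ∀ X, {i | walkEdges (γ i).walk = X}.Finite)
    (h : LoopNormLE (Real.log (3 / 2)) γ c (93 / 500)) :
    PerturbedMassGapAtS 4 2 ((1 / 16 : ℝ) / 4) (loopFamilyAction (d := 4) 2 γ c) :=
  perturbedMassGapAtS_loopFamilyAction su2_rowS32_1_16 hfin h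

/-- **Every `N ≥ 2`, `d = 4`, 't Hooft coupling `1/64`**: every generic Wilson-type loop action with finite carrier
fibres and `‖c‖_{log (6/5)} ≤ 1/40` has the mass gap, with `N`-uniform radius (row `suN_rowS_1_64`). -/
theorem suN_loopFamily_massGapS_1_64 {N : ℕ} (hN : 2 ≤ N) (hfin : ∀ X, {i | walkEdges (γ i).walk = X}.Finite)
    (h : LoopNormLE (Real.log (6 / 5)) γ c (1 / 40)) :
    PerturbedMassGapAtS 4 N (1 / 64) (loopFamilyAction (d := 4) N γ c) :=
  suN_rowS_1_64 hN _ ((memBallZdS_loopFamilyAction hfin h).mono (by norm_num) (by norm_num))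

/-- **`SU(3)`, `d = 4`, `β_W = 1/8`, GIVEN the two certified one-link constants** (`OneLinkPoincareSUN 3 (3/5) (4/5)`,
`OneLinkVarianceBound 3 (11/30) (49/20)`): radius `0.116` at weight `2^{dist}` (row `su3_rowS2_1_8`). -/
theorem su3_loopFamily_massGapS_1_8 (hP : OneLinkPoincareSUN 3 (3 / 5) (4 / 5))
    (hV : OneLinkVarianceBound 3 (11 / 30) (49 / 20)) (hfin : ∀ X, {i | walkEdges (γ i).walk = X}.Finite)
    (h : LoopNormLE (Real.log 2) γ c (29 / 250)) :
    PerturbedMassGapAtS 4 3 ((1 / 8 : ℝ) / 9) (loopFamilyAction (d := 4) 3 γ c) :=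
  perturbedMassGapAtS_loopFamilyAction (su3_rowS2_1_8 hP hV) hfin h

/-- **Cell, target-type form**: `MassGapOnLoopBall 4 2 ((1/16)/4) (log 2) 0.143` — `SU(2)`, `d = 4`, `β_W = 1/16`. -/
theorem su2_massGapOnLoopBall_1_16 : MassGapOnLoopBall 4 2 ((1 / 16 : ℝ) / 4) (Real.log 2) (143 / 1000) :=
  su2_rowBS2_1_16.massGapOnLoopBall

/-- **Cell, target-type form**: `MassGapOnLoopBall 4 2 ((1/20)/4) (log 2) 0.209` — `SU(2)`, `d = 4`, `β_W = 1/20`. -/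
theorem su2_massGapOnLoopBall_1_20 : MassGapOnLoopBall 4 2 ((1 / 20 : ℝ) / 4) (Real.log 2) (209 / 1000) :=
  su2_rowBS2_1_20.massGapOnLoopBall

/-- **Cell, target-type form, every `N ≥ 2`**: `MassGapOnLoopBall 4 N (1/64) (log (6/5)) (1/40)`. -/
theorem suN_massGapOnLoopBall_1_64 {N : ℕ} (hN : 2 ≤ N) : MassGapOnLoopBall 4 N (1 / 64) (Real.log (6 / 5)) (1 / 40) :=
  fun _ _ _ hfin h => suN_rowS_1_64 hN _ ((memBallZdS_loopFamilyAction hfin h).mono (by norm_num) (by norm_num))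

/-- **Cell, target-type form, `SU(3)` given `H1`, `H2`**: `MassGapOnLoopBall 4 3 ((1/8)/9) (log 2) 0.116`. -/
theorem su3_massGapOnLoopBall_1_8 (hP : OneLinkPoincareSUN 3 (3 / 5) (4 / 5))
    (hV : OneLinkVarianceBound 3 (11 / 30) (49 / 20)) : MassGapOnLoopBall 4 3 ((1 / 8 : ℝ) / 9) (Real.log 2) (29 / 250) :=
  (su3_rowS2_1_8 hP hV).massGapOnLoopBall

end Rows

end Summit.Ventures.YMGap.RobustBall

end
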